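import Summits.BirchSwinnertonDyer.BirchSwinnertonDyer.Theses.PrintCf2
import Summits.BirchSwinnertonDyer.BirchSwinnertonDyer.Theorems.PrintCf2RamifiedOffTYZSquareSilenceThreeSevenSeven
import HarnessLib

/-!
# Route `PrintCf2`, aside stmt-BirchSwinnertonDyer-23443 `RamifiedLowerHalfThreeSevenSevenOfFacts` — CLOSER BY NAME

The aside filed by planner g21 (route A rev 52) under crux stmt-BirchSwinnertonDyer-20509 / item 23431 (C⁺ lower half, `k = 3`
even cell `(3,7,7)`): for square-free `n = 2abc` with `a ≡ 3`, `b ≡ c ≡ 7 (mod 8)` and `(b/a) = (c/a) = −1`,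
`ord_{s=1} L(E_n, s) = 1` and a non-special generator `(x, y)` of `E_n(ℚ)` modulo torsion (`x ∉ {±1, ±n, ±2, ±2n}·ℚ²`),
every TYZ value `𝓛(n)` is even — modulo `tyz_cmPointRingClassFrobeniusValueData ∧ thm11_parity_of_scriptL ∧
rank_eq_analyticRank_of_analyticRank_le_one`.  Proved BY NAME by
`Summit.BirchSwinnertonDyer.PrintCf2.ThreeSevenSeven.two_dvd_scriptL_three_seven_seven_of_facts` of the crux LEAD
(cruxlead-20509 g13, p743627), whose type is the item text VERBATIM.  CONDITIONAL on the three named facts (hypotheses of the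
statement, no `_holds`); crux 20509 / item 23431 are NOT closed by this file; BSD is not proved by any of this.

References: [cite: TianYuanZhang2017, Thm. 3.5, Lemma 3.18, §3.1, Prop. 3.2 (2), Thm. 3.6 (2), proof of Lemma 3.21];
[cite: Cox2013, §1 (1.13)–(1.15), §5.C Lemma 5.19, (5.22), Thm. 5.23, Cor. 5.25, §9.A]; [cite: Stevenhagen1995RedeiMatrices, §2];
[cite: Darmon2004, Thm. 3.22].
-/

set_option linter.dupNamespace false

namespace Summit.BirchSwinnertonDyer.BirchSwinnertonDyer.Theorems

/-- **Aside `RamifiedLowerHalfThreeSevenSevenOfFacts` (stmt-BirchSwinnertonDyer-23443), by name**: cell `(3,7,7)` of the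
`k = 3` even lower half of C⁺ — `n = 2abc`, `a ≡ 3`, `b ≡ c ≡ 7 (mod 8)`, `(b/a) = (c/a) = −1`, `ord_{s=1} L(E_n, s) = 1`, a
non-special generator of `E_n(ℚ)/tors` ⟹ `2 ∣ L` for every `L` with `IsScriptL n L`, granted the three named facts.
[cite: TianYuanZhang2017, Thm. 3.5, Lemma 3.18, Prop. 3.2 (2), Thm. 3.6 (2), proof of Lemma 3.21]
[cite: Cox2013, §5.C Lemma 5.19, (5.22), Thm. 5.23, Cor. 5.25, §9.A] [cite: Stevenhagen1995RedeiMatrices, §2] [cite: Darmon2004, Thm. 3.22] -/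
theorem ramifiedLowerHalfThreeSevenSevenOfFacts_proof :
    Summit.BirchSwinnertonDyer.BirchSwinnertonDyer.Theses.PrintCf2.RamifiedLowerHalfThreeSevenSevenOfFacts := by
  unfold Summit.BirchSwinnertonDyer.BirchSwinnertonDyer.Theses.PrintCf2.RamifiedLowerHalfThreeSevenSevenOfFacts
  exact Summit.BirchSwinnertonDyer.PrintCf2.ThreeSevenSeven.two_dvd_scriptL_three_seven_seven_of_facts

end Summit.BirchSwinnertonDyer.BirchSwinnertonDyer.Theorems
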